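import Mathlib.RingTheory.Polynomial.Cyclotomic.Basic
import Mathlib.Data.ZMod.Basic
import HarnessLib

/-!
# Postema–Kokkelmans 2026, Lemma 3.3 and the proof step of Theorem 3.5, AS PRINTED (statements only)

J. J. Postema, S. J. J. M. F. Kokkelmans, *Existence and Characterization of Bivariate Bicycle Codes*, IEEE Trans. Inf.
Theory 72 (9) (2026) 6728–6739 = arXiv:2502.17052v4 [PostemaKokkelmans2026]. Venture QEC (cell `qec`), item 02.PK26L33
(qec-type-02; statements typed by qec-lit-4, second independent read HOME/lit/evidence/PK26-THM35-READ2-lit4.md, every locator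
read on the page; qec-lit-3's first read 01:29:58Z / 02:13:41Z). This file holds STATEMENTS ONLY (named Props, D-0014): the
tree refutes them in `CoprimeBivariateBicycleDegenerate.lean` (engine: qec-lit-3's `Phi85Trinomials.lean`), so these `def … :
Prop` are permanently NON-dischargeable named statements — recorded because the census object of cell `(170, 16)`
(`Summits/Ventures/QEC/Census/BB/BB170k16/Dimension.lean`, `k = 16` at `ℓm = 85`) is the witness against them.

Printed text (verbatim, PDF page/line of the lit rendition `paper:arxiv-2502.17052`):
* Lemma 3.2 (p. 15 L1–6): «For prime `p`, `Φ_p(x) = f_1(x)···f_η(x)` is factorised into `η` minimal polynomials `f_i(x)` that all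
  divide trinomials, in two cases only: • `p` is a Mersenne prime, i.e. of the form `p = 2^s − 1` for some `s ∈ ℕ`, • `p` is an
  outlier, of which the currently known members (`< 3·10⁶`) are 73, 121 369, 178 481, 262 657 and 599 479.»
* Lemma 3.3 (p. 15 L13–15; no ansatz in the statement): «For non-prime `n`, `Φ_n(x) = f_1(x)···f_η(x)` is factorised into `η`
  minimal polynomials `f_i(x)` that all divide trinomials if and only if `p | n` such that `Φ_p(x) | t(x)` for some trinomial
  `t(x)`.» (Its printed proof, L16–27, argues the «if» direction only.)
* Theorem 3.5, proof (p. 16 L17–19): «For coprime BB codes, the result is trivial, since `gcd(a(z), b(z), z^{ℓm} − 1)` is only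
  non-trivial if and only if `ℓm` has a Mersenne prime or an outlier prime as a factor, by virtue of Lemma 3.3.» (Context: Thm 2.2
  p. 9: `ℓ`, `m` coprime and odd, `z = ψ(xy)`; p. 9 L34–39: «arbitrary univariate trinomials as the ansatz»; «trinomial» = `1 + x^a
  + x^b`, p. 9 «we will henceforth set their lowest power to 0», Lemma 3.1 proof.)

Typing choices (lit-4 READ-2 §6, adopted): «minimal polynomials of `Φ_n`» over `𝔽₂` = the irreducible factors of `cyclotomic n
(ZMod 2)` (Def. 1.6 / p. 6 L1–4); «`Φ_p(x) | t(x)`» on the right of Lemma 3.3 is read AS IN LEMMA 3.2 (the minimal polynomials of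
`Φ_p` divide trinomials) — the reading the proof of Thm 3.5 uses (`PK26_lemma33_asPrinted`); the literal reading (the whole `Φ_p`
divides one trinomial) is kept as `PK26_lemma33_literal` for the referee; «outlier» is read BY ITS DEFINING PROPERTY (a non-Mersenne
prime whose `Φ_p` has trinomial-dividing minimal polynomials), the printed list being «the currently known members»; «`gcd` non-trivial»
= a common divisor of positive degree. Mathlib `Polynomial` / `cyclotomic` vocabulary is forced by the statement (noncomputable
semantics; statements only). No instance, no notation.
-/

namespace Literature.InformationTheory.QuantumCodes

open Polynomial

namespace PK26

/-- A TRINOMIAL over `𝔽₂` in the sense of the paper: `1 + X^a + X^b` with `0 < a < b` («arbitrary univariate trinomials … we will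
henceforth set their lowest power to 0», p. 9; Lemma 3.1 proof: «a trinomial `1 + x^a + x^b`»). A predicate (definition).
[cite: PostemaKokkelmans2026, §2 p. 9 L34-39 and Lemma 3.1 proof p. 14 (trinomial 1 + x^a + x^b)] -/
def IsTrinomial (t : (ZMod 2)[X]) : Prop :=
  ∃ a b : ℕ, 0 < a ∧ a < b ∧ t = 1 + X ^ a + X ^ b

/-- «`Φ_n(x) = f_1(x)⋯f_η(x)` is factorised into `η` minimal polynomials `f_i(x)` that ALL divide trinomials»: every irreducible
factor of the `n`-th cyclotomic polynomial over `𝔽₂` divides some trinomial. A predicate (definition).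
[cite: PostemaKokkelmans2026, Lemma 3.3 p. 15 L13-14; Def. 1.6 / p. 6 L1-4 (minimal polynomials = irreducible factors of Φ_n over 𝔽₂)] -/
def AllMinimalPolynomialsDivideTrinomials (n : ℕ) : Prop :=
  ∀ f : (ZMod 2)[X], Irreducible f → f ∣ cyclotomic n (ZMod 2) → ∃ t, IsTrinomial t ∧ f ∣ t

/-- «`p` is a Mersenne prime, i.e. of the form `p = 2^s − 1` for some `s ∈ ℕ`». A predicate (definition).
[cite: PostemaKokkelmans2026, Lemma 3.2 p. 15 L3-4] -/
def IsMersennePrime (p : ℕ) : Prop :=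
  p.Prime ∧ ∃ s : ℕ, p = 2 ^ s - 1

/-- «`p` is an outlier» — read by its DEFINING PROPERTY in Lemma 3.2: a prime, not Mersenne, all of whose minimal polynomials of
`Φ_p` over `𝔽₂` divide trinomials (the printed list 73, 121369, 178481, 262657, 599479 = «the currently known members (< 3·10⁶)»).
A predicate (definition). [cite: PostemaKokkelmans2026, Lemma 3.2 p. 15 L1-6] -/
def IsOutlierPrime (p : ℕ) : Prop :=
  p.Prime ∧ ¬ IsMersennePrime p ∧ AllMinimalPolynomialsDivideTrinomials p

/-- **Lemma 3.3 as printed** (RHS «`Φ_p(x) | t(x)`» read as in Lemma 3.2, i.e. the minimal polynomials of `Φ_p` divide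
trinomials — the reading used in the proof of Thm 3.5): «For non-prime `n`, `Φ_n(x) = f_1(x)···f_η(x)` is factorised into `η`
minimal polynomials `f_i(x)` that all divide trinomials if and only if `p | n` such that `Φ_p(x) | t(x)` for some trinomial `t(x)`.»
Named statement (D-0014); REFUTED in the tree at `n = 85` (`CoprimeBivariateBicycleDegenerate.lean`), hence never dischargeable.
[cite: PostemaKokkelmans2026, Lemma 3.3 p. 15 L13-15] -/
def PK26_lemma33_asPrinted : Prop :=
  ∀ n : ℕ, 2 ≤ n → ¬ n.Prime →
    (AllMinimalPolynomialsDivideTrinomials n ↔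
      ∃ p : ℕ, p.Prime ∧ p ∣ n ∧ AllMinimalPolynomialsDivideTrinomials p)

/-- **Lemma 3.3, literal reading of the right-hand side** («`Φ_p(x) | t(x)` for some trinomial `t(x)`»: the whole cyclotomic
polynomial divides one trinomial) — recorded for the referee only; even further from true (already `Φ₇ = (1+x+x³)(1+x²+x³)`
divides no trinomial). Named statement (D-0014). [cite: PostemaKokkelmans2026, Lemma 3.3 p. 15 L13-15 (literal reading)] -/
def PK26_lemma33_literal : Prop :=
  ∀ n : ℕ, 2 ≤ n → ¬ n.Prime →
    (AllMinimalPolynomialsDivideTrinomials n ↔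
      ∃ p : ℕ, p.Prime ∧ p ∣ n ∧ ∃ t, IsTrinomial t ∧ cyclotomic p (ZMod 2) ∣ t)

/-- **The proof step of Theorem 3.5 as printed** (p. 16 L17–19): for coprime odd `ℓ`, `m` (Thm 2.2) and univariate trinomial
constructors `a(z)`, `b(z)` (p. 9 ansatz), «`gcd(a(z), b(z), z^{ℓm} − 1)` is only non-trivial if and only if `ℓm` has a Mersenne
prime or an outlier prime as a factor» — «non-trivial» = a common divisor of positive degree; «outlier» by its defining property.
`a`, `b` range over NORMALISED trinomials `1 + X^a + X^b`; the paper's constructors `z^i + z^j + z^k` differ from these by a unit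
power of `z` modulo `z^{ℓm} − 1`, which does not change the gcd with `z^{ℓm} − 1`, so this universally quantified form is WEAKER
than the printed sentence and refuting it refutes the printed step a fortiori (qec-lit-4 co-read 2026-08-27).
Named statement (D-0014); REFUTED in the tree at `(ℓ, m) = (5, 17)`, `a = 1 + z + z¹⁶`, `b = 1 + z⁴ + z⁶⁴` (the census code of
cell `(170, 16)`, `k = 16`). [cite: PostemaKokkelmans2026, Theorem 3.5 proof p. 16 L17-19; Thm 2.2 p. 9 L1-2; §2 p. 9 L34-39] -/
def PK26_thm35_proofStep_asPrinted : Prop :=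
  ∀ ℓ m : ℕ, Odd ℓ → Odd m → ℓ.Coprime m → ∀ a b : (ZMod 2)[X], IsTrinomial a → IsTrinomial b →
    ((∃ g : (ZMod 2)[X], 0 < g.natDegree ∧ g ∣ a ∧ g ∣ b ∧ g ∣ X ^ (ℓ * m) - 1) ↔
      ∃ p : ℕ, p ∣ ℓ * m ∧ (IsMersennePrime p ∨ IsOutlierPrime p))

/-- The shape of the refutation of Lemma 3.3 at `n = 85 = 5 · 17` (qec-lit-4's reduction, proved): if every minimal polynomial of
`Φ₈₅` divides a trinomial while neither those of `Φ₅` nor those of `Φ₁₇` do, the lemma is false.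
[cite: PostemaKokkelmans2026, Lemma 3.3 p. 15 L13-15 (reduction of its negation to three facts at n = 85)] -/
theorem lemma33_false_shape (hL : AllMinimalPolynomialsDivideTrinomials 85) (h5 : ¬ AllMinimalPolynomialsDivideTrinomials 5)
    (h17 : ¬ AllMinimalPolynomialsDivideTrinomials 17) : ¬ PK26_lemma33_asPrinted := by
  intro h
  obtain ⟨p, hp, hpd, hpT⟩ := (h 85 (by norm_num) (by decide)).mp hL
  have h85 : (85 : ℕ) = 5 * 17 := by norm_num
  rw [h85, hp.dvd_mul] at hpd
  rcases hpd with h | h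
  · have := (Nat.prime_dvd_prime_iff_eq hp (by decide)).mp h
    subst this; exact h5 hpT
  · have := (Nat.prime_dvd_prime_iff_eq hp (by decide)).mp h
    subst this; exact h17 hpT

/-- Likewise for the proof step of Theorem 3.5 at `(ℓ, m) = (5, 17)`: a positive-degree common divisor of `a`, `b`, `z⁸⁵ − 1` for
trinomials `a`, `b`, together with «5 and 17 are neither Mersenne nor outliers», refutes it.
[cite: PostemaKokkelmans2026, Theorem 3.5 proof p. 16 L17-19 (reduction of its negation at ℓm = 85)] -/
theorem thm35_proofStep_false_shape {a b g : (ZMod 2)[X]} (ha : IsTrinomial a) (hb : IsTrinomial b) (hg : 0 < g.natDegree)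
    (hga : g ∣ a) (hgb : g ∣ b) (hg85 : g ∣ X ^ (5 * 17) - 1)
    (h5M : ¬ IsMersennePrime 5) (h17M : ¬ IsMersennePrime 17)
    (h5 : ¬ AllMinimalPolynomialsDivideTrinomials 5) (h17 : ¬ AllMinimalPolynomialsDivideTrinomials 17) :
    ¬ PK26_thm35_proofStep_asPrinted := by
  intro h
  have hiff := h 5 17 (by decide) (by decide) (by decide) a b ha hb
  obtain ⟨p, hpd, hp⟩ := hiff.mp ⟨g, hg, hga, hgb, hg85⟩
  have hprime : p.Prime := by
    rcases hp with hp | hp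
    · exact hp.1
    · exact hp.1
  rw [hprime.dvd_mul] at hpd
  rcases hpd with hd | hd
  · have := (Nat.prime_dvd_prime_iff_eq hprime (by decide)).mp hd
    subst this
    rcases hp with hp | hp
    · exact h5M hp
    · exact h5 hp.2.2
  · have := (Nat.prime_dvd_prime_iff_eq hprime (by decide)).mp hd
    subst this
    rcases hp with hp | hp
    · exact h17M hp
    · exact h17 hp.2.2

end PK26

end Literature.InformationTheory.QuantumCodes
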